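import Mathlib
import Summits.Schanuel.Schanuel.Theses.RigidCore
import Summits.Schanuel.Schanuel.Theorems.AclSubsetLogFreeCore.Negative.ExpAclDefinability
import Literature.ModelTheory.ExponentialFields.DefinabilityParams

/-!
# ARITHMETIC TRANSFER: ring-definable subsets of `ℤ^α` are `∅`-definable in `ℂ_exp`
# (crux stmt-Schanuel-0969 `RigidCore.MinimalCounterexampleInAcl` — arithmetic isolation, transfer half)

Line `kernel-arithmetic-selection` (lead prover-line-stmt-Schanuel-0969-c12-0), `--supports stmt-Schanuel-0969`; infrastructure for the
registered stub `stub_geThree` (= item stmt-Schanuel-14744) on its corank-one sector, companion of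
Theorems/…DefinableClassSelector (`stub_corankOne_definablePattern`).

`ℤ ⊆ ℂ` is `∅`-definable in `ℂ_exp = (ℂ, +, ·, −, 0, 1, exp)` (`intSet`, Kirby–Macintyre–Onshuus 2012 §2.2) and its ring operations are
the restrictions of those of `ℂ`.  Hence every subset of `ℤ^α` (`α` finite) that is `∅`-definable in the RING `ℤ` — in particular every
ARITHMETICAL set — has an `∅`-definable copy in `ℂ^α`: relativise the defining ring formula to `intSet`.  We prove this semantically, by
induction on bounded ring formulas, never touching Mathlib's syntactic `relabel`:

* `definableFun_realize_ringTerm` — the function `ℂ^β → ℂ` defined by a ring term is `∅`-definable in `ℂ_exp`;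
* `realize_ringTerm_intCast` — ring terms commute with `ℤ → ℂ`;
* `exists_definable_relativization` — for every bounded ring formula `φ(α; x₁…x_k)` there is an `∅`-definable `T ⊆ ℂ^{α ⊕ k}` whose
  integer points are exactly the integer solutions of `φ` (quantifiers relativised to `intSet`);
* `definable_intCast_image_of_ringDefinable` (registered form `stub_arithmeticTransfer`) — **if `S ⊆ ℤ^α` is `∅`-definable in the ring
  `ℤ`, then `{(w_a)_a : w ∈ S} ⊆ ℂ^α` is `∅`-definable in `ℂ_exp`.**

Both structures enter only through Mathlib's compatibility class `FirstOrder.Ring.CompatibleRing` (any `Language.ring`-structure on `ℤ`,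
resp. `ℂ`, whose symbols are interpreted by `+, ·, −, 0, 1`); instantiate with `FirstOrder.Ring.compatibleRingOfRing ℤ`.

USE (status note `Cruxes/MinimalCounterexampleInAcl/Lines/kernel_arithmetic_selection.md` §Addendum c12): the hit pattern `H_x ⊆ ℤ^m` of a
corank-one first failure is arithmetical (its coordinates are computable), so by this file and Gödel's arithmetical definability of
recursive relations its copy is `∅`-definable in `ℂ_exp`, which is the first hypothesis of `stub_corankOne_definablePattern`.

References: [KirbyMacintyreOnshuus2012] J. Kirby, A. Macintyre, A. Onshuus, *The algebraic numbers definable in various exponential fields*,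
J. Inst. Math. Jussieu 11 (2012), arXiv:1101.4224, §2.2 (`ℤ` is `∅`-definable in `ℂ_exp`; the theory of `ℂ_exp` interprets arithmetic);
[Marker2002] D. Marker, *Model Theory: An Introduction*, GTM 217, §1.3 (relativisation to a definable subset).
-/

noncomputable section

set_option linter.dupNamespace false

open Complex Set FirstOrder FirstOrder.Language

namespace Summit.Schanuel.Schanuel.Cruxes.MinimalCounterexampleInAcl.KernelArithmeticSelection

open Literature.ModelTheory.ExponentialFields
open Summit.Schanuel.Schanuel.Theorems.AclSubsetLogFreeCore.Negative

/-! ## Ring terms inside `ℂ_exp` -/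

/-- The function `ℂ^β → ℂ` defined by a ring term (a polynomial expression in the variables) is `∅`-definable in `ℂ_exp`, for any
compatible ring-language structure on `ℂ` (induction on the term; `+, ·, −, 0, 1` are symbols of `ℂ_exp`). [folklore] -/
theorem definableFun_realize_ringTerm [FirstOrder.Ring.CompatibleRing ℂ] {β : Type*} (t : Language.ring.Term β) :
    (∅ : Set ℂ).DefinableFun Language.expRing (fun w : β → ℂ => t.realize w) := by
  induction t with
  | var b => exact definableFun_proj_params b
  | func f ts ih =>
    cases f with
    | add =>
      have e : (fun w : β → ℂ => (Term.func FirstOrder.ringFunc.add ts).realize w) =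
          fun w => (ts 0).realize w + (ts 1).realize w := by
        funext w
        rw [Term.realize_func]
        exact FirstOrder.Ring.CompatibleRing.funMap_add _
      rw [e]; exact definableFun_add' (ih 0) (ih 1)
    | mul =>
      have e : (fun w : β → ℂ => (Term.func FirstOrder.ringFunc.mul ts).realize w) =
          fun w => (ts 0).realize w * (ts 1).realize w := by
        funext w
        rw [Term.realize_func]
        exact FirstOrder.Ring.CompatibleRing.funMap_mul _
      rw [e]; exact definableFun_mul' (ih 0) (ih 1)
    | neg =>
      have e : (fun w : β → ℂ => (Term.func FirstOrder.ringFunc.neg ts).realize w) =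
          fun w => -(ts 0).realize w := by
        funext w
        rw [Term.realize_func]
        exact FirstOrder.Ring.CompatibleRing.funMap_neg _
      rw [e]; exact definableFun_neg' (ih 0)
    | zero =>
      have e : (fun w : β → ℂ => (Term.func FirstOrder.ringFunc.zero ts).realize w) = fun _ => (0 : ℂ) := by
        funext w
        rw [Term.realize_func]
        exact FirstOrder.Ring.CompatibleRing.funMap_zero _
      rw [e]; exact definableFun_zero'
    | one =>
      have e : (fun w : β → ℂ => (Term.func FirstOrder.ringFunc.one ts).realize w) = fun _ => (1 : ℂ) := by
        funext w
        rw [Term.realize_func]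
        exact FirstOrder.Ring.CompatibleRing.funMap_one _
      rw [e]; exact definableFun_one'

/-- Ring terms commute with the cast `ℤ → ℂ` (a ring homomorphism), for any compatible ring-language structures on `ℤ` and `ℂ`.
[folklore] -/
theorem realize_ringTerm_intCast [FirstOrder.Ring.CompatibleRing ℤ] [FirstOrder.Ring.CompatibleRing ℂ] {β : Type*}
    (t : Language.ring.Term β) (w : β → ℤ) :
    t.realize (fun b => ((w b : ℤ) : ℂ)) = ((t.realize w : ℤ) : ℂ) := by
  induction t with
  | var b => rfl
  | func f ts ih =>
    cases f with
    | add =>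
      rw [Term.realize_func, Term.realize_func, FirstOrder.Ring.CompatibleRing.funMap_add,
        FirstOrder.Ring.CompatibleRing.funMap_add, ih 0, ih 1, Int.cast_add]
    | mul =>
      rw [Term.realize_func, Term.realize_func, FirstOrder.Ring.CompatibleRing.funMap_mul,
        FirstOrder.Ring.CompatibleRing.funMap_mul, ih 0, ih 1, Int.cast_mul]
    | neg =>
      rw [Term.realize_func, Term.realize_func, FirstOrder.Ring.CompatibleRing.funMap_neg,
        FirstOrder.Ring.CompatibleRing.funMap_neg, ih 0, Int.cast_neg]
    | zero =>
      rw [Term.realize_func, Term.realize_func, FirstOrder.Ring.CompatibleRing.funMap_zero,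
        FirstOrder.Ring.CompatibleRing.funMap_zero, Int.cast_zero]
    | one =>
      rw [Term.realize_func, Term.realize_func, FirstOrder.Ring.CompatibleRing.funMap_one,
        FirstOrder.Ring.CompatibleRing.funMap_one, Int.cast_one]

/-! ## Relativisation of bounded ring formulas to `intSet` -/

/-- The integer-valued assignment `α ⊕ Fin k → ℂ` built from `v : α → ℤ` and `xs : Fin k → ℤ`. -/
theorem sumElim_intCast {α : Type*} {k : ℕ} (v : α → ℤ) (xs : Fin k → ℤ) :
    (Sum.elim (fun a => ((v a : ℤ) : ℂ)) (fun i => ((xs i : ℤ) : ℂ))) = fun s => ((Sum.elim v xs s : ℤ) : ℂ) := by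
  funext s; cases s <;> rfl

/-- **Relativisation, semantically.**  For every bounded formula `φ` of the language of rings with free variables `α` and `k` bound
variables in scope there is a subset `T ⊆ ℂ^{α ⊕ k}`, `∅`-definable in `ℂ_exp`, whose INTEGER points are exactly the integer assignments
satisfying `φ` in the ring `ℤ` (induction on `φ`: equations by `definableFun_realize_ringTerm` and `realize_ringTerm_intCast`, implications
by Boolean combination, and `∀` relativised to the `∅`-definable `intSet = ℤ`, KMO 2012 §2.2). [cite: KirbyMacintyreOnshuus2012, §2.2] -/
theorem exists_definable_relativization [FirstOrder.Ring.CompatibleRing ℤ] [FirstOrder.Ring.CompatibleRing ℂ] {α : Type*} :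
    ∀ {k : ℕ} (φ : Language.ring.BoundedFormula α k),
      ∃ T : Set (α ⊕ Fin k → ℂ), (∅ : Set ℂ).Definable Language.expRing T ∧
        ∀ (v : α → ℤ) (xs : Fin k → ℤ),
          (Sum.elim (fun a => ((v a : ℤ) : ℂ)) (fun i => ((xs i : ℤ) : ℂ))) ∈ T ↔ φ.Realize v xs
  | _, BoundedFormula.falsum => ⟨∅, Set.definable_empty, fun v xs => by simp [BoundedFormula.Realize]⟩
  | _, BoundedFormula.equal t₁ t₂ => by
      refine ⟨{w | t₁.realize w = t₂.realize w},
        definable_setOf_eq_params (definableFun_realize_ringTerm t₁) (definableFun_realize_ringTerm t₂), fun v xs => ?_⟩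
      simp only [Set.mem_setOf_eq, BoundedFormula.Realize, sumElim_intCast, realize_ringTerm_intCast, Int.cast_inj]
  | _, BoundedFormula.rel R _ => R.elim
  | _, BoundedFormula.imp φ ψ => by
      obtain ⟨T₁, hT₁, h₁⟩ := exists_definable_relativization φ
      obtain ⟨T₂, hT₂, h₂⟩ := exists_definable_relativization ψ
      refine ⟨{w | w ∈ T₁ → w ∈ T₂}, definable_setOf_imp_params hT₁ hT₂, fun v xs => ?_⟩
      simp only [Set.mem_setOf_eq, BoundedFormula.Realize, h₁, h₂]
  | k, BoundedFormula.all φ => by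
      obtain ⟨T, hT, h⟩ := exists_definable_relativization φ
      -- reindexing `α ⊕ Fin (k+1) → (α ⊕ Fin k) ⊕ Unit`: the last bound variable becomes the `Unit` slot
      let g : α ⊕ Fin (k + 1) → (α ⊕ Fin k) ⊕ Unit :=
        Sum.elim (fun a => Sum.inl (Sum.inl a)) (fun i => Fin.lastCases (Sum.inr ()) (fun j => Sum.inl (Sum.inr j)) i)
      refine ⟨{w : α ⊕ Fin k → ℂ | ∀ z : ℂ, z ∈ intSet → (Sum.elim w (fun _ : Unit => z)) ∘ g ∈ T}, ?_, fun v xs => ?_⟩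
      · refine definable_setOf_forall_params (definable_setOf_imp_params ?_ ?_)
        · exact definable_mem_intSet (definableFun_proj_params _)
        · have hpre := hT.preimage_comp g
          convert hpre using 1
          ext w
          simp only [Set.mem_setOf_eq, Set.mem_preimage]
          constructor <;> intro hw <;> convert hw using 2 <;> funext s <;> rcases s with s | u <;> simp
      · simp only [Set.mem_setOf_eq]
        rw [show (BoundedFormula.all φ).Realize v xs ↔ ∀ z : ℤ, φ.Realize v (Fin.snoc xs z) from Iff.rfl]
        constructor
        · intro hw z
          rw [← h]
          have hz := hw (z : ℂ) (mem_intSet_iff.2 ⟨z, rfl⟩)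
          convert hz using 1
          funext s
          rcases s with a | i
          · rfl
          · refine Fin.lastCases ?_ (fun j => ?_) i
            · simp [g]
            · simp [g]
        · intro hw z hz
          obtain ⟨z, rfl⟩ := mem_intSet_iff.1 hz
          have h' := (h v (Fin.snoc xs z)).2 (hw z)
          convert h' using 1
          funext s
          rcases s with a | i
          · rfl
          · refine Fin.lastCases ?_ (fun j => ?_) i
            · simp [g]
            · simp [g]

/-! ## The transfer theorem -/

/-- **ARITHMETIC TRANSFER.**  If `S ⊆ ℤ^α` (`α` finite) is `∅`-definable in the ring `ℤ` (any compatible ring-language structure, e.g.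
`FirstOrder.Ring.compatibleRingOfRing ℤ`), then its copy `{(w_a)_a : w ∈ S} ⊆ ℂ^α` is `∅`-definable in `ℂ_exp`: write `S` by a ring formula,
relativise it to `intSet = ℤ` (`exists_definable_relativization`) and add the conjuncts `v_a ∈ intSet`.  In particular every arithmetical
subset of `ℤ^α` is `∅`-definable in `ℂ_exp`. [cite: KirbyMacintyreOnshuus2012, §2.2] -/
theorem definable_intCast_image_of_ringDefinable [FirstOrder.Ring.CompatibleRing ℤ] {α : Type*} [Finite α] {S : Set (α → ℤ)}
    (hS : (∅ : Set ℤ).Definable Language.ring S) :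
    (∅ : Set ℂ).Definable Language.expRing {v : α → ℂ | ∃ w ∈ S, ∀ a, v a = ((w a : ℤ) : ℂ)} := by
  letI : FirstOrder.Ring.CompatibleRing ℂ := FirstOrder.Ring.compatibleRingOfRing ℂ
  obtain ⟨φ, hφ⟩ := Set.empty_definable_iff.1 hS
  obtain ⟨T, hT, hTφ⟩ := exists_definable_relativization (α := α) φ
  -- reindex `α → α ⊕ Fin 0`
  have hT' : (∅ : Set ℂ).Definable Language.expRing {v : α → ℂ | (v ∘ Sum.elim id Fin.elim0 : α ⊕ Fin 0 → ℂ) ∈ T} :=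
    hT.preimage_comp (Sum.elim id Fin.elim0)
  have hZ : (∅ : Set ℂ).Definable Language.expRing {v : α → ℂ | ∀ a, v a ∈ intSet} := by
    rw [Set.setOf_forall]
    exact Set.definable_iInter_of_finite fun a => definable_mem_intSet (definableFun_proj_params _)
  have h := hZ.inter hT'
  convert h using 1
  ext v
  simp only [Set.mem_setOf_eq, Set.mem_inter_iff]
  constructor
  · rintro ⟨w, hw, hv⟩
    have ev : v = fun a => ((w a : ℤ) : ℂ) := funext hv
    subst ev
    refine ⟨fun a => mem_intSet_iff.2 ⟨w a, rfl⟩, ?_⟩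
    have hreal : Formula.Realize φ w := by rw [hφ] at hw; exact hw
    unfold Formula.Realize at hreal
    have hreal' : BoundedFormula.Realize φ w Fin.elim0 := by
      convert hreal using 2
    have h0 := (hTφ w Fin.elim0).2 hreal'
    convert h0 using 1
    funext s; rcases s with a | i
    · rfl
    · exact i.elim0
  · rintro ⟨hv, hvT⟩
    choose w hw using fun a => mem_intSet_iff.1 (hv a)
    refine ⟨w, ?_, hw⟩
    have goal : BoundedFormula.Realize φ w Fin.elim0 := by
      rw [← hTφ w Fin.elim0]
      convert hvT using 1
      funext s; rcases s with a | i
      · exact (hw a).symm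
      · exact i.elim0
    rw [hφ]
    simp only [Set.mem_setOf_eq]
    unfold Formula.Realize
    convert goal using 2

/-! ## Registered form (`ledger workitem stub-add stmt-Schanuel-0969 --name stub_arithmeticTransfer …`) -/

/-- Registered form of `definable_intCast_image_of_ringDefinable` at `α = Fin m` with Mathlib's `compatibleRingOfRing ℤ` (stub
`stub_arithmeticTransfer` of crux stmt-Schanuel-0969, line kernel-arithmetic-selection, lead c12): a subset of `ℤ^m` that is `∅`-definable in the
ring `ℤ` has an `∅`-definable copy in `ℂ_exp`. -/
theorem stub_arithmeticTransfer : ∀ (m : ℕ) (S : Set (Fin m → ℤ)), (letI := FirstOrder.Ring.compatibleRingOfRing ℤ; (∅ : Set ℤ).Definable FirstOrder.Language.ring S) → (∅ : Set ℂ).Definable Literature.ModelTheory.ExponentialFields.Language.expRing {v : Fin m → ℂ | ∃ w ∈ S, ∀ a, v a = ((w a : ℤ) : ℂ)} := by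
  intro m S hS
  letI := FirstOrder.Ring.compatibleRingOfRing ℤ
  exact definable_intCast_image_of_ringDefinable hS

end Summit.Schanuel.Schanuel.Cruxes.MinimalCounterexampleInAcl.KernelArithmeticSelection

end
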